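import Literature.Geometry.Kaehler.RiemannSurfaceRiemannRochSecondForm
import Literature.Topology.CoveringSpaces.FiniteCoveringProper
import HarnessLib

/-!
# Riemann–Hurwitz for unramified coverings: an unramified holomorphic map of degree `d` between compact
# Riemann surfaces satisfies `g(M) − 1 = d · (g(N) − 1)`; topological covering maps are unramified
# (Farkas–Kra I.2.7, V.1.10; Miranda II.4.16 / IV Prop. 2.9)

Layer `Literature/Geometry/Kaehler`, sequel WITHOUT definitions of `RiemannSurfaceHurwitzFormulaCanonical`
(`MeromorphicOneForm.degree_divisor_eq_mul_degree_divisor_add : deg div θ_M = d · deg div θ_N + deg R_F`),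
`RiemannSurfaceRiemannRochSecondForm` (`degree_divisor_eq_two_mul_arithGenus_sub_two : deg div θ = 2g − 2`,
`exists_meromorphicOrderAt_ne_top`), `RiemannSurfaceDegree` (`exists_finsum_ramificationNumber_eq`,
`ncard_preimage_singleton_eq_finsum`), `RiemannSurfaceRamification` (`exists_injOn_iff_ramificationNumber_eq_one`)
and of the lane's `Topology/CoveringSpaces/FiniteCoveringProper` (`IsCoveringMap.isProperMap_of_finite`).

H. M. Farkas, I. Kra, *Riemann Surfaces*, GTM 71 (1992), I.2.7 (the Riemann–Hurwitz relation
`2g − 2 = n(2γ − 2) + B` for an `n`-sheeted covering with total branching `B`; «smooth (unramified)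
coverings: `B = 0`») and V.1.10 («By Riemann-Hurwitz, the [unramified double] cover `M` has genus `3`»);
R. Miranda, *Algebraic Curves and Riemann Surfaces* (1995), Chapter II Theorem 4.16 (Hurwitz's formula)
and Definition 4.2 (`mult_p F = 1` iff `F` is a local homeomorphism at `p`).

## What is proved (everything; no definitions, no instances, no named facts)

For a holomorphic map `F : M → N` between compact connected Riemann surfaces:
* §1 `ramificationNumber_eq_one_of_isLocallyInjective` / **`ramificationNumber_eq_one_of_isLocalHomeomorph`**
  (a local homeomorphism — in particular a topological covering map, `IsCoveringMap.ramificationNumber_eq_one` —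
  is unramified), `exists_ncard_preimage_eq_of_unramified` (all fibres of an unramified `F` have `deg F` points),
  `ramificationDiv_eq_zero_of_unramified`, `degree_ramificationDiv_eq_zero_of_unramified`;
* §2 **`arithGenus_sub_one_eq_of_unramified`**: `g(M) − 1 = d · (g(N) − 1)` for an unramified `F` whose fibres
  have `d` points (Riemann–Hurwitz with `B = 0`), the `ℕ` form `arithGenus_add_eq_of_unramified`, and the
  corollaries `arithGenus_le_of_unramified` (`g(N) ≤ g(M)`), `arithGenus_eq_one_iff_of_unramified` (`g(M) = 1 ↔
  g(N) = 1`), `arithGenus_eq_of_unramified_of_arithGenus_eq` (`g(M) = g(N) ≥ 2 ⇒ d = 1`);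
* §3 topological coverings of a compact Riemann surface: `IsCoveringMap.surjective_of_finite` (a covering map
  with finite fibres and non-empty total space onto a connected base is onto),
  `IsCoveringMap.compactSpace_of_finite`, `IsCoveringMap.t2Space`, **`IsCoveringMap.arithGenus_sub_one_eq`**
  (`g(M) − 1 = #F⁻¹(y) · (g(N) − 1)` for a holomorphic covering map `F : M → N` of compact Riemann surfaces),
  `IsCoveringMap.arithGenus_eq_one_iff`, `IsCoveringMap.bijective_of_arithGenus_eq` (same genus `≥ 2 ⇒` one sheet).

## References

* H. M. Farkas, I. Kra, *Riemann Surfaces*, GTM 71, 2nd ed., Springer (1992), I.2.7, V.1.10. [FarkasKra1992]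
* R. Miranda, *Algebraic Curves and Riemann Surfaces*, GSM 5, AMS (1995), Chapter II Definition 4.2,
  Theorem 4.16. [Miranda1995]
-/

noncomputable section

open scoped Manifold ContDiff Topology
open Set Function Filter

namespace Literature.Geometry.Kaehler

namespace RiemannSurface

open MeromorphicOneForm Literature.Topology.CoveringSpaces

universe u v

variable {M : Type u} [TopologicalSpace M] [ChartedSpace ℂ M] [IsManifold 𝓘(ℂ, ℂ) ω M]
  [CompactSpace M] [T2Space M] [ConnectedSpace M]
variable {N : Type v} [TopologicalSpace N] [ChartedSpace ℂ N] [IsManifold 𝓘(ℂ, ℂ) ω N]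
  [CompactSpace N] [T2Space N] [ConnectedSpace N]
variable {F : M → N}

/-! ### §1 Local homeomorphisms are unramified; fibres of an unramified map -/

omit [CompactSpace M] [T2Space M] [CompactSpace N] [T2Space N] [ConnectedSpace N] in
/-- A non-constant holomorphic map which is injective near `P` has ramification number `1` at `P`.
[cite: Miranda1995, Chapter II Definition 4.2] [cite: FarkasKra1992, I.1.6] -/
theorem ramificationNumber_eq_one_of_exists_injOn (hF : MDifferentiable 𝓘(ℂ, ℂ) 𝓘(ℂ, ℂ) F)
    (hne : ∃ x y, F x ≠ F y) {P : M} (hP : ∃ U ∈ 𝓝 P, InjOn F U) : ramificationNumber F P = 1 :=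
  haveI := (inferInstance : ConnectedSpace M).toPreconnectedSpace
  (exists_injOn_iff_ramificationNumber_eq_one hF.continuous.continuousAt (Eventually.of_forall fun y ↦ hF y)
    (ramificationNumber_pos_of_exists_ne hF hne P)).1 hP

omit [CompactSpace M] [T2Space M] [CompactSpace N] [T2Space N] [ConnectedSpace N] in
/-- **A holomorphic local homeomorphism is unramified**: `mult_P F = 1` everywhere («`F` is a local
homeomorphism at `p` iff `mult_p F = 1`»). [cite: Miranda1995, Chapter II Definition 4.2 and the remark following Lemma 4.4] -/
theorem ramificationNumber_eq_one_of_isLocalHomeomorph (hF : MDifferentiable 𝓘(ℂ, ℂ) 𝓘(ℂ, ℂ) F)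
    (hl : IsLocalHomeomorph F) (hne : ∃ x y, F x ≠ F y) (P : M) : ramificationNumber F P = 1 := by
  obtain ⟨e, hPe, he⟩ := hl P
  exact ramificationNumber_eq_one_of_exists_injOn hF hne
    ⟨e.source, e.open_source.mem_nhds hPe, fun x hx y hy hxy ↦ e.injOn hx hy (by rw [← he]; exact hxy)⟩

omit [CompactSpace M] [T2Space M] [CompactSpace N] [T2Space N] [ConnectedSpace N] in
/-- **A holomorphic topological covering map is unramified.** [cite: Miranda1995, Chapter II Definition 4.2] [cite: FarkasKra1992, I.2.7 («smooth coverings»)] -/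
theorem _root_.IsCoveringMap.ramificationNumber_eq_one (hc : IsCoveringMap F)
    (hF : MDifferentiable 𝓘(ℂ, ℂ) 𝓘(ℂ, ℂ) F) (hne : ∃ x y, F x ≠ F y) (P : M) : ramificationNumber F P = 1 :=
  ramificationNumber_eq_one_of_isLocalHomeomorph hF hc.isLocalHomeomorph hne P

omit [ConnectedSpace N] in
/-- **All fibres of an unramified map have `deg F` points**: there is `d ≥ 1` with `#F⁻¹(Q) = d` and
`Σ_{P ↦ Q} mult_P F = d` for every `Q`. [cite: Miranda1995, Chapter II Proposition 4.8, Definition 4.2] -/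
theorem exists_ncard_preimage_eq_of_unramified [PreconnectedSpace N] (hF : MDifferentiable 𝓘(ℂ, ℂ) 𝓘(ℂ, ℂ) F)
    (hne : ∃ x y, F x ≠ F y) (h1 : ∀ P, ramificationNumber F P = 1) :
    ∃ d : ℕ, 0 < d ∧ (∀ Q, (F ⁻¹' {Q}).ncard = d) ∧ ∀ Q, ∑ᶠ P ∈ F ⁻¹' {Q}, ramificationNumber F P = d := by
  haveI := (inferInstance : ConnectedSpace M).toPreconnectedSpace
  obtain ⟨d, hd, hsum⟩ := exists_finsum_ramificationNumber_eq hF hne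
  exact ⟨d, hd, fun Q ↦ by rw [ncard_preimage_singleton_eq_finsum hF hne (fun P _ ↦ h1 P), hsum Q], hsum⟩

omit [T2Space M] [CompactSpace N] [T2Space N] [ConnectedSpace N] in
/-- The ramification divisor of a non-constant unramified map vanishes. [cite: Miranda1995, Chapter V Definition 1.18] -/
theorem ramificationDiv_eq_zero_of_unramified (hF : MDifferentiable 𝓘(ℂ, ℂ) 𝓘(ℂ, ℂ) F) (hne : ∃ x y, F x ≠ F y)
    (h1 : ∀ P, ramificationNumber F P = 1) : ramificationDiv F = 0 := by
  haveI := (inferInstance : ConnectedSpace M).toPreconnectedSpace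
  ext P
  rw [ramificationDiv_apply hF hne, h1 P, Nat.cast_one, sub_self, Finsupp.coe_zero, Pi.zero_apply]

omit [T2Space M] [CompactSpace N] [T2Space N] [ConnectedSpace N] in
/-- `deg R_F = 0` for a non-constant unramified map («`B = 0`»). [cite: FarkasKra1992, I.2.7] -/
theorem degree_ramificationDiv_eq_zero_of_unramified (hF : MDifferentiable 𝓘(ℂ, ℂ) 𝓘(ℂ, ℂ) F)
    (hne : ∃ x y, F x ≠ F y) (h1 : ∀ P, ramificationNumber F P = 1) :
    Finsupp.degree (ramificationDiv F) = 0 := by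
  rw [ramificationDiv_eq_zero_of_unramified hF hne h1, map_zero]

/-! ### §2 Riemann–Hurwitz with `B = 0`: `g(M) − 1 = d (g(N) − 1)` -/

/-- **Riemann–Hurwitz for an unramified covering: `g(M) − 1 = d · (g(N) − 1)`** for a non-constant
unramified holomorphic `F : M → N` between compact Riemann surfaces all of whose fibres have `d` points
(`2g − 2 = n(2γ − 2) + B` with `B = 0`). [cite: FarkasKra1992, I.2.7] [cite: Miranda1995, Chapter II Theorem 4.16] -/
theorem arithGenus_sub_one_eq_of_unramified (hF : MDifferentiable 𝓘(ℂ, ℂ) 𝓘(ℂ, ℂ) F) (hne : ∃ x y, F x ≠ F y)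
    (h1 : ∀ P, ramificationNumber F P = 1) {d : ℕ} (hd : ∀ Q, (F ⁻¹' {Q}).ncard = d) :
    (arithGenus M : ℤ) - 1 = d * ((arithGenus N : ℤ) - 1) := by
  haveI := (inferInstance : ConnectedSpace M).toPreconnectedSpace
  haveI := (inferInstance : ConnectedSpace N).toPreconnectedSpace
  obtain ⟨d', -, hd', hsum⟩ := exists_ncard_preimage_eq_of_unramified hF hne h1
  obtain ⟨x, -, -⟩ := id hne
  obtain rfl : d = d' := (hd (F x)).symm.trans (hd' (F x))
  obtain ⟨θ, hθ⟩ := exists_meromorphicOrderAt_ne_top (M := M)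
  obtain ⟨η, hη⟩ := exists_meromorphicOrderAt_ne_top (M := N)
  have h := degree_divisor_eq_mul_degree_divisor_add hF hne hsum hθ hη
  rw [degree_divisor_eq_two_mul_arithGenus_sub_two hθ, degree_divisor_eq_two_mul_arithGenus_sub_two hη,
    degree_ramificationDiv_eq_zero_of_unramified hF hne h1, add_zero] at h
  linarith

/-- `ℕ` form: `g(M) + d = d · g(N) + 1`. [cite: FarkasKra1992, I.2.7] -/
theorem arithGenus_add_eq_of_unramified (hF : MDifferentiable 𝓘(ℂ, ℂ) 𝓘(ℂ, ℂ) F) (hne : ∃ x y, F x ≠ F y)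
    (h1 : ∀ P, ramificationNumber F P = 1) {d : ℕ} (hd : ∀ Q, (F ⁻¹' {Q}).ncard = d) :
    arithGenus M + d = d * arithGenus N + 1 := by
  have h := arithGenus_sub_one_eq_of_unramified hF hne h1 hd
  have h' : (arithGenus M : ℤ) + d = d * arithGenus N + 1 := by linarith
  exact_mod_cast h'

/-- `g(N) ≤ g(M)` for an unramified covering `M → N` (`d ≥ 1`; for `g(N) = 0` trivially).
[cite: FarkasKra1992, I.2.7] -/
theorem arithGenus_le_of_unramified (hF : MDifferentiable 𝓘(ℂ, ℂ) 𝓘(ℂ, ℂ) F) (hne : ∃ x y, F x ≠ F y)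
    (h1 : ∀ P, ramificationNumber F P = 1) : arithGenus N ≤ arithGenus M := by
  haveI := (inferInstance : ConnectedSpace N).toPreconnectedSpace
  obtain ⟨d, hd0, hd, -⟩ := exists_ncard_preimage_eq_of_unramified hF hne h1
  have h := arithGenus_add_eq_of_unramified hF hne h1 hd
  rcases Nat.eq_zero_or_pos (arithGenus N) with h0 | hpos
  · rw [h0]; exact Nat.zero_le _
  · nlinarith

/-- **`g(M) = 1 ↔ g(N) = 1`** for an unramified covering (`g(M) − 1 = d (g(N) − 1)`, `d ≥ 1`).
[cite: FarkasKra1992, I.2.7, V.1.10] -/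
theorem arithGenus_eq_one_iff_of_unramified (hF : MDifferentiable 𝓘(ℂ, ℂ) 𝓘(ℂ, ℂ) F) (hne : ∃ x y, F x ≠ F y)
    (h1 : ∀ P, ramificationNumber F P = 1) : arithGenus M = 1 ↔ arithGenus N = 1 := by
  haveI := (inferInstance : ConnectedSpace N).toPreconnectedSpace
  obtain ⟨d, hd0, hd, -⟩ := exists_ncard_preimage_eq_of_unramified hF hne h1
  have h := arithGenus_sub_one_eq_of_unramified hF hne h1 hd
  have hd0' : (0 : ℤ) < d := by exact_mod_cast hd0
  constructor
  · intro hM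
    rw [hM, Nat.cast_one, sub_self, eq_comm, mul_eq_zero] at h
    rcases h with h | h
    · exact absurd h hd0'.ne'
    · have h' : (arithGenus N : ℤ) = 1 := by linarith
      exact_mod_cast h'
  · intro hN
    rw [hN, Nat.cast_one, sub_self, mul_zero, sub_eq_zero] at h
    exact_mod_cast h

/-- **An unramified covering between surfaces of the same genus `g ≥ 2` is one-sheeted** (`(d − 1)(g − 1) = 0`).
[cite: FarkasKra1992, I.2.7] -/
theorem ncard_preimage_eq_one_of_unramified_of_arithGenus_eq (hF : MDifferentiable 𝓘(ℂ, ℂ) 𝓘(ℂ, ℂ) F)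
    (hne : ∃ x y, F x ≠ F y) (h1 : ∀ P, ramificationNumber F P = 1) (hg : arithGenus M = arithGenus N)
    (h2 : 2 ≤ arithGenus N) (Q : N) : (F ⁻¹' {Q}).ncard = 1 := by
  haveI := (inferInstance : ConnectedSpace N).toPreconnectedSpace
  obtain ⟨d, hd0, hd, -⟩ := exists_ncard_preimage_eq_of_unramified hF hne h1
  have h := arithGenus_sub_one_eq_of_unramified hF hne h1 hd
  rw [hg] at h
  have hd1 : (d : ℤ) = 1 := by
    have hpos : (0 : ℤ) < (arithGenus N : ℤ) - 1 := by
      have : (2 : ℤ) ≤ arithGenus N := by exact_mod_cast h2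
      linarith
    have := mul_right_cancel₀ hpos.ne' ((one_mul _).trans h)
    exact this.symm
  rw [hd Q]
  exact_mod_cast hd1

/-! ### §3 Topological covering maps onto a compact Riemann surface -/

omit [ChartedSpace ℂ M] [IsManifold 𝓘(ℂ, ℂ) ω M] [CompactSpace M] [T2Space M] [ConnectedSpace M] [ChartedSpace ℂ N]
  [IsManifold 𝓘(ℂ, ℂ) ω N] [CompactSpace N] [T2Space N] in
/-- A covering map with finite fibres from a non-empty space onto a connected space is surjective
(its range is open, being that of a local homeomorphism, and closed, the map being proper). [cite: HatcherAT2002, §1.3 (covering spaces, p. 56)] -/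
theorem _root_.IsCoveringMap.surjective_of_finite [Nonempty M] (hc : IsCoveringMap F)
    (hfin : ∀ y, (F ⁻¹' {y}).Finite) : Surjective F := by
  haveI := (inferInstance : ConnectedSpace N).toPreconnectedSpace
  have hr : range F = univ :=
    IsClopen.eq_univ ⟨(hc.isProperMap_of_finite hfin).isClosedMap.isClosed_range,
      hc.isLocalHomeomorph.isOpenMap.isOpen_range⟩ (range_nonempty F)
  exact range_eq_univ.1 hr

omit [ChartedSpace ℂ M] [IsManifold 𝓘(ℂ, ℂ) ω M] [CompactSpace M] [T2Space M] [ConnectedSpace M]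
  [ChartedSpace ℂ N] [IsManifold 𝓘(ℂ, ℂ) ω N] [T2Space N] [ConnectedSpace N] in
/-- The total space of a covering with finite fibres of a compact space is compact (the covering map is
proper). [cite: HatcherAT2002, §1.3 (covering spaces)] -/
theorem _root_.IsCoveringMap.compactSpace_of_finite (hc : IsCoveringMap F) (hfin : ∀ y, (F ⁻¹' {y}).Finite) :
    CompactSpace M :=
  ⟨by rw [← preimage_univ (f := F)]; exact (hc.isProperMap_of_finite hfin).isCompact_preimage isCompact_univ⟩

omit [ChartedSpace ℂ M] [IsManifold 𝓘(ℂ, ℂ) ω M] [CompactSpace M] [T2Space M] [ConnectedSpace M]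
  [ChartedSpace ℂ N] [IsManifold 𝓘(ℂ, ℂ) ω N] [CompactSpace N] [ConnectedSpace N] in
/-- The total space of a covering of a Hausdorff space is Hausdorff (points in different fibres are
separated by preimages of separating open sets, points in one fibre by the sheets). [cite: HatcherAT2002, §1.3 (covering spaces)] -/
theorem _root_.IsCoveringMap.t2Space (hc : IsCoveringMap F) : T2Space M := by
  refine ⟨fun a b hne ↦ ?_⟩
  by_cases h : F a = F b
  · exact hc.isSeparatedMap a b h hne
  · obtain ⟨u, v, hu, hv, hau, hbv, huv⟩ := t2_separation h
    exact ⟨F ⁻¹' u, F ⁻¹' v, hu.preimage hc.continuous, hv.preimage hc.continuous, hau, hbv, huv.preimage F⟩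

/-- **Riemann–Hurwitz for a holomorphic covering map of compact Riemann surfaces: `g(M) − 1 = #F⁻¹(Q) · (g(N) − 1)`**
(a topological covering map is unramified and all its fibres have `deg F` points).
[cite: FarkasKra1992, I.2.7 («smooth coverings», `B = 0`)] [cite: Miranda1995, Chapter II Theorem 4.16] -/
theorem _root_.IsCoveringMap.arithGenus_sub_one_eq (hc : IsCoveringMap F) (hF : MDifferentiable 𝓘(ℂ, ℂ) 𝓘(ℂ, ℂ) F)
    (hne : ∃ x y, F x ≠ F y) (Q : N) :
    (arithGenus M : ℤ) - 1 = (F ⁻¹' {Q}).ncard * ((arithGenus N : ℤ) - 1) := by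
  haveI := (inferInstance : ConnectedSpace N).toPreconnectedSpace
  have h1 := hc.ramificationNumber_eq_one hF hne
  obtain ⟨d, -, hd, -⟩ := exists_ncard_preimage_eq_of_unramified hF hne h1
  rw [hd Q]
  exact arithGenus_sub_one_eq_of_unramified hF hne h1 hd

/-- For a holomorphic covering map of compact Riemann surfaces, `g(M) = 1 ↔ g(N) = 1`.
[cite: FarkasKra1992, I.2.7, V.1.10] -/
theorem _root_.IsCoveringMap.arithGenus_eq_one_iff (hc : IsCoveringMap F) (hF : MDifferentiable 𝓘(ℂ, ℂ) 𝓘(ℂ, ℂ) F)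
    (hne : ∃ x y, F x ≠ F y) : arithGenus M = 1 ↔ arithGenus N = 1 :=
  arithGenus_eq_one_iff_of_unramified hF hne (hc.ramificationNumber_eq_one hF hne)

/-- **A holomorphic covering map between compact Riemann surfaces of the same genus `g ≥ 2` is a
homeomorphism onto** (one-sheeted, hence bijective). [cite: FarkasKra1992, I.2.7] -/
theorem _root_.IsCoveringMap.bijective_of_arithGenus_eq (hc : IsCoveringMap F) (hF : MDifferentiable 𝓘(ℂ, ℂ) 𝓘(ℂ, ℂ) F)
    (hne : ∃ x y, F x ≠ F y) (hg : arithGenus M = arithGenus N) (h2 : 2 ≤ arithGenus N) : Bijective F := by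
  haveI := (inferInstance : ConnectedSpace M).toPreconnectedSpace
  have h1 := hc.ramificationNumber_eq_one hF hne
  refine bijective_of_finsum_ramificationNumber_eq_one hF hne fun Q ↦ ?_
  rw [← ncard_preimage_singleton_eq_finsum hF hne (fun P _ ↦ h1 P)]
  exact ncard_preimage_eq_one_of_unramified_of_arithGenus_eq hF hne h1 hg h2 Q

end RiemannSurface

end Literature.Geometry.Kaehler

end
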